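import Mathlib
import Summits.Ventures.PercRepro2.HCov
import Summits.Ventures.PercRepro2.BlockSubstClass
import Summits.Ventures.PercRepro2.PocketConn
import Summits.Ventures.PercRepro2.RECMReduction
import Summits.Ventures.PercRepro2.A3Reduction
import Summits.Ventures.PercRepro2.GcBlock
import Summits.Ventures.PercRepro2.GcSkelReductionC
import Summits.Ventures.PercRepro2.GcSkelReductionMin
import Summits.Ventures.PercRepro2.GcSkelReductionO
import Summits.Ventures.PercRepro2.GcSkelReductionOB
import Summits.Ventures.PercRepro2.GcSkelReductionMinOB
import Summits.Ventures.PercRepro2.GcSkelReductionH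
import Summits.Ventures.PercRepro2.GcSkelReductionMinH
import Summits.Ventures.PercRepro2.GcSkelReductionActive
import Summits.Ventures.PercRepro2.GcSkelReductionZ
import Summits.Ventures.PercRepro2.A3RootEdgeAll

/-!
# The class of record is symmetric in the roots (blind cell PercRepro2, typer-1 g56)

(HCOV) is symmetric under `a₁ ↔ a₂` (`HCov_swap`), and so is every clause of the class of
record `WReducedMinHAZ`: the root-dependent predicates are symmetric up to the order of their
disjuncts (`RootsToMarks`, `A3ToMarks`, `IsPocket`, `OToMarks`, `PoleHubToMarks`, `TwoThree`,
`IsRootsEdge`, `Unmarked` and with it `HasBlock`, `OneActiveUnmarked`), the mirror pairs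
`sep3 / sep3'` and `notSeven / notSeven'` exchange, the necklace clause re-indexes its terminals,
the six-terminal class has mine-2's `sixTerminalClass_swap`, and the five-terminal class relabels
the skeleton by the transposition `1 ↔ 2` (**`fiveTerminalClass_swap`**). Hence
**`wredMinHAZ_swap`** : `WReducedMinHAZ ends o a₁ a₂ a₃ b → WReducedMinHAZ ends o a₂ a₁ a₃ b`
(with `wredMin_swap`, `wredMinOB_swap`, `wredMinH_swap`, `wredMinHA_swap` on the way) — the
licence for every WLOG normalisation of the root order on the class of record
(`GcSkelNorm.lean`). Standard axioms.
-/

namespace Summit.Ventures.PercRepro2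

open CovForm RECM

namespace WRed

/-! ## The predicates -/

section Predicates

variable {V : Type*} {E : Type*}

/-- `Unmarked` is symmetric in the roots. -/
lemma unmarked_swap {o a₁ a₂ a₃ b y : V} (h : Unmarked o a₁ a₂ a₃ b y) :
    Unmarked o a₂ a₁ a₃ b y :=
  ⟨h.1, h.2.2.1, h.2.1, h.2.2.2.1, h.2.2.2.2⟩

/-- Class `R` is symmetric in the roots. -/
lemma rootsToMarks_swap {ends : E → Sym2 V} {o a₁ a₂ a₃ b : V}
    (h : RootsToMarks ends o a₁ a₂ a₃ b) : RootsToMarks ends o a₂ a₁ a₃ b := by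
  intro e he z hz
  have := h e he.symm z hz
  tauto

/-- Class `R₃` is symmetric in the roots. -/
lemma a3ToMarks_swap {ends : E → Sym2 V} {o a₁ a₂ a₃ b : V}
    (h : A3RECM.A3ToMarks ends o a₁ a₂ a₃ b) : A3RECM.A3ToMarks ends o a₂ a₁ a₃ b := by
  intro e he z hz
  have := h e he z hz
  tauto

/-- A root-only pocket is symmetric in the roots. -/
lemma isPocket_swap {ends : E → Sym2 V} {P : Set V} {a₁ a₂ : V}
    (h : PocketConn.IsPocket ends P a₁ a₂) : PocketConn.IsPocket ends P a₂ a₁ := by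
  intro e x y hxy hx
  have := h e x y hxy hx
  tauto

/-- The star class of `o` is symmetric in the roots. -/
lemma oToMarks_swap {ends : E → Sym2 V} {o a₁ a₂ b : V} (h : OToMarks ends o a₁ a₂ b) :
    OToMarks ends o a₂ a₁ b := by
  intro e he hd
  have := h e he hd
  tauto

/-- The pole-hub class is symmetric in the roots. -/
lemma poleHubToMarks_swap {ends : E → Sym2 V} {o a₁ a₂ a₃ b : V}
    (h : PoleHubToMarks ends o a₁ a₂ a₃ b) : PoleHubToMarks ends o a₂ a₁ a₃ b := by
  intro e hd he
  have := h e hd he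
  tauto

/-- `OneActiveUnmarked` is symmetric in the roots. -/
lemma oneActiveUnmarked_swap {ends : E → Sym2 V} {o a₁ a₂ a₃ b : V}
    (h : OneActiveUnmarked ends o a₁ a₂ a₃ b) : OneActiveUnmarked ends o a₂ a₁ a₃ b :=
  fun x y hx hy hex hey => h x y (unmarked_swap hx) (unmarked_swap hy) hex hey

/-- An edge among the roots is one for the swapped roots. -/
lemma isRootsEdge_swap {ends : E → Sym2 V} {a₁ a₂ a₃ : V} {e : E}
    (h : IsRootsEdge ends a₁ a₂ a₃ e) : IsRootsEdge ends a₂ a₁ a₃ e := by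
  rcases h with h | h
  · exact Or.inl (by rw [h, Sym2.eq_swap])
  · right
    unfold RootEdge.IsRootEdge at h ⊢
    tauto

/-- The `2 + 3` splits are symmetric in the roots. -/
lemma twoThree_swap {L : Set V} {v : V} {Rt : Set V} {o a₁ a₂ a₃ b : V}
    (h : TwoThree L v Rt o a₁ a₂ a₃ b) : TwoThree L v Rt o a₂ a₁ a₃ b := by
  unfold TwoThree at h ⊢
  rcases h with ⟨h1, h2, h3, h4, h5⟩ | ⟨h1, h2, h3, h4, h5⟩ | ⟨h1, h2, h3, h4, h5⟩ |
    ⟨h1, h2, h3, h4, h5⟩ | ⟨h1, h2, h3, h4, h5⟩ | ⟨h1, h2, h3, h4, h5⟩ | ⟨h1, h2, h3, h4, h5⟩ |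
    ⟨h1, h2, h3, h4, h5⟩ | ⟨h1, h2, h3, h4, h5⟩ | ⟨h1, h2, h3, h4, h5⟩
  · exact Or.inl ⟨h2, h1, h3, h4, h5⟩
  · exact Or.inr (Or.inr (Or.inl ⟨h1, h2, h3, h4, h5⟩))
  · exact Or.inr (Or.inl ⟨h1, h2, h3, h4, h5⟩)
  · exact Or.inr (Or.inr (Or.inr (Or.inr (Or.inl ⟨h1, h2, h3, h4, h5⟩))))
  · exact Or.inr (Or.inr (Or.inr (Or.inl ⟨h1, h2, h3, h4, h5⟩)))
  · exact Or.inr (Or.inr (Or.inr (Or.inr (Or.inr (Or.inr (Or.inl ⟨h1, h2, h3, h4, h5⟩))))))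
  · exact Or.inr (Or.inr (Or.inr (Or.inr (Or.inr (Or.inl ⟨h1, h2, h3, h4, h5⟩)))))
  · exact Or.inr (Or.inr (Or.inr (Or.inr (Or.inr (Or.inr (Or.inr (Or.inl ⟨h1, h2, h4, h3, h5⟩)))))))
  · exact Or.inr (Or.inr (Or.inr (Or.inr (Or.inr (Or.inr (Or.inr (Or.inr
      (Or.inl ⟨h1, h2, h4, h3, h5⟩))))))))
  · exact Or.inr (Or.inr (Or.inr (Or.inr (Or.inr (Or.inr (Or.inr (Or.inr (Or.inr
      ⟨h1, h2, h4, h3, h5⟩))))))))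

/-- A collapsible mark-free block is one for the swapped roots. -/
lemma hasBlock_swap {ends : E → Sym2 V} {o a₁ a₂ a₃ b : V} (h : Block.HasBlock ends o a₁ a₂ a₃ b) :
    Block.HasBlock ends o a₂ a₁ a₃ b := by
  obtain ⟨W, u, v, hB, hW, hrest⟩ := h
  exact ⟨W, u, v, hB, fun y hy => unmarked_swap (hW y hy), hrest⟩

end Predicates

/-! ## The five-terminal class -/

section Five

/-- The transposition `1 ↔ 2` of `Fin 5`. -/
def swap12five : Fin 5 → Fin 5 := fun k => if k = 1 then 2 else if k = 2 then 1 else k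

/-- `swap12five` is an involution. -/
lemma swap12five_swap12five : ∀ k, swap12five (swap12five k) = k := by
  decide

/-- `swap12five` is injective. -/
lemma swap12five_injective : Function.Injective swap12five := by
  intro k k' h
  rw [← swap12five_swap12five k, h, swap12five_swap12five]

/-- `Sym2.map` of an injection preserves non-diagonality. -/
lemma not_isDiag_map_of_injective {α β : Type*} {f : α → β} (hf : Function.Injective f)
    {z : Sym2 α} (hz : ¬ z.IsDiag) : ¬ (z.map f).IsDiag := by
  induction z using Sym2.ind with
  | h x y =>
    rw [Sym2.map_mk, Sym2.mk_isDiag_iff] at *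
    exact fun hxy => hz (hf hxy)

variable {V : Type*} {E : Type*}

/-- **The five-terminal class is symmetric in the roots**: relabel the skeleton's terminals by
the transposition `1 ↔ 2`. -/
theorem fiveTerminalClass_swap {ends : E → Sym2 V} {o a₁ a₂ a₃ b : V}
    (h : BlockSubst.FiveTerminalClass ends o a₁ a₂ a₃ b) :
    BlockSubst.FiveTerminalClass ends o a₂ a₁ a₃ b := by
  obtain ⟨E', _, _, ends', q, blk, Vj, hloop, hinj, hB, h0, h1, h2, h3, h4⟩ := h
  refine ⟨E', inferInstance, inferInstance, fun j => (ends' j).map swap12five, q ∘ swap12five,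
    blk, Vj, fun j => not_isDiag_map_of_injective swap12five_injective (hloop j),
    (Sym2.map.injective swap12five_injective).comp hinj, ?_, h0, h2, h1, h3, h4⟩
  refine ⟨hB.ends_mem, ?_, ?_, ?_, hB.q_inj.comp swap12five_injective⟩
  · intro j k hk
    rw [Sym2.mem_map] at hk
    obtain ⟨k', hk', rfl⟩ := hk
    show q (swap12five (swap12five k')) ∈ Vj j
    rw [swap12five_swap12five]
    exact hB.term_mem j k' hk'
  · intro j j' hjj x hx hx'
    obtain ⟨k, hk, hxk⟩ := hB.inter_terms j j' hjj x hx hx'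
    refine ⟨swap12five k, ?_, ?_⟩
    · rw [Sym2.mem_map]
      exact ⟨k, hk, rfl⟩
    · show x = q (swap12five (swap12five k))
      rw [swap12five_swap12five]
      exact hxk
  · intro j k hk
    have := hB.term_only j (swap12five k) hk
    rw [Sym2.mem_map]
    exact ⟨swap12five k, this, swap12five_swap12five k⟩

end Five

/-! ## The classes -/

section Classes

variable {V : Type*} {E : Type*} [Fintype E] [DecidableEq V]

/-- **`WReducedMin` is symmetric in the roots.** -/
theorem wredMin_swap {ends : E → Sym2 V} {o a₁ a₂ a₃ b : V} (h : WReducedMin ends o a₁ a₂ a₃ b) :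
    WReducedMin ends o a₂ a₁ a₃ b where
  simple := h.simple
  noBlock := fun hB => h.noBlock (hasBlock_swap hB)
  deg_o := h.deg_o
  deg_b := h.deg_b
  deg_a1 := h.deg_a2
  deg_a2 := h.deg_a1
  leaf_a3 := fun e x he hx hd => unmarked_swap (h.leaf_a3 e x he hx hd)
  twoThree := fun side L v Rt hc htt => h.twoThree side L v Rt hc (twoThree_swap htt)
  notR := fun hR => h.notR (rootsToMarks_swap hR)
  notR3 := fun hR => h.notR3 (a3ToMarks_swap hR)
  noPocket := fun P hP h3 h2 h1 ho => h.noPocket P (isPocket_swap hP) h3 h1 h2 ho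
  sep2 := by rw [Set.pair_comm]; exact h.sep2
  sep3 := h.sep3'
  sep3' := h.sep3
  noNecklace := fun q blk Vj hN ko k₁ k₂ k₃ kb h01 h02 h03 h04 h12 h13 h14 h23 h24 h34 hqo hq1
      hq2 hq3 =>
    h.noNecklace q blk Vj hN ko k₂ k₁ k₃ kb h02 h01 h03 h04 (Ne.symm h12) h23 h24 h13 h14 h34 hqo
      hq2 hq1 hq3
  notFive := fun h5 => h.notFive (fiveTerminalClass_swap h5)
  notSix := fun h6 => h.notSix (BlockSubst.sixTerminalClass_swap h6)
  notSeven := h.notSeven'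
  notSeven' := h.notSeven
  notIso_a1 := h.notIso_a2
  notIso_a2 := h.notIso_a1
  notIso_o := h.notIso_o
  notIso_b := h.notIso_b

/-- **`WReducedMinOB` is symmetric in the roots.** -/
theorem wredMinOB_swap {ends : E → Sym2 V} {o a₁ a₂ a₃ b : V}
    (h : WReducedMinOB ends o a₁ a₂ a₃ b) : WReducedMinOB ends o a₂ a₁ a₃ b where
  toWReducedMin := wredMin_swap h.toWReducedMin
  notOStar := fun hs => h.notOStar (oToMarks_swap hs)
  notBStar := fun hs => h.notBStar (oToMarks_swap hs)
  notOA3B := h.notOA3B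

/-- **`WReducedMinH` is symmetric in the roots.** -/
theorem wredMinH_swap {ends : E → Sym2 V} {o a₁ a₂ a₃ b : V}
    (h : WReducedMinH ends o a₁ a₂ a₃ b) : WReducedMinH ends o a₂ a₁ a₃ b where
  toWReducedMinOB := wredMinOB_swap h.toWReducedMinOB
  notPoleHub := fun hh => h.notPoleHub (poleHubToMarks_swap hh)

/-- **`WReducedMinHA` is symmetric in the roots.** -/
theorem wredMinHA_swap {ends : E → Sym2 V} {o a₁ a₂ a₃ b : V}
    (h : WReducedMinHA ends o a₁ a₂ a₃ b) : WReducedMinHA ends o a₂ a₁ a₃ b where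
  toWReducedMinH := wredMinH_swap h.toWReducedMinH
  twoActive := fun ha => h.twoActive (oneActiveUnmarked_swap ha)

/-- **THE CLASS OF RECORD IS SYMMETRIC IN THE ROOTS.** -/
theorem wredMinHAZ_swap {ends : E → Sym2 V} {o a₁ a₂ a₃ b : V}
    (h : WReducedMinHAZ ends o a₁ a₂ a₃ b) : WReducedMinHAZ ends o a₂ a₁ a₃ b where
  toWReducedMinHA := wredMinHA_swap h.toWReducedMinHA
  noRootsEdge := fun e he => h.noRootsEdge e (isRootsEdge_swap he)

/-- The class of record in either root order. -/
theorem wredMinHAZ_swap_iff {ends : E → Sym2 V} {o a₁ a₂ a₃ b : V} :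
    WReducedMinHAZ ends o a₁ a₂ a₃ b ↔ WReducedMinHAZ ends o a₂ a₁ a₃ b :=
  ⟨wredMinHAZ_swap, wredMinHAZ_swap⟩

end Classes

end WRed

end Summit.Ventures.PercRepro2
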